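/-
Copyright (c) 2026. All rights reserved.
Released under Apache 2.0 license as described in the file LICENSE.
Authors: abc-iut cell, prover seat abc-iut-w6-d031 (gen 5; PROOF-ONLY: parabolic elements of `SL₂(ℤ)`
are conjugate to translations — input of the parabolic case of the great Picard theorem via `λ`).
-/
import Mathlib.NumberTheory.Modular
import Mathlib.NumberTheory.ModularForms.CongruenceSubgroups
import HarnessLib

/-!
# Parabolic elements of `SL₂(ℤ)` are `SL₂(ℤ)`-conjugate to translations

F. Diamond, J. Shurman, *A First Course in Modular Forms* (2005), §2.4 (cusps): every element of
`ℚ ∪ {∞}` is `SL₂(ℤ)`-equivalent to `∞`, so an element of `SL₂(ℤ)` of trace `±2` — whose fixed point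
on `ℙ¹(ℝ)` is rational — is conjugate IN `SL₂(ℤ)` to `±[[1, h], [0, 1]]`, acting on `ℍ` as the
translation `z ↦ z + h`.  PROOF-ONLY (no definitions, no named facts):

* `SL2Z.exists_conj_apply_one_zero_eq_zero` — `(tr γ)² = 4` ⇒ `∃ A ∈ SL₂(ℤ)`, `(A γ A⁻¹)₁₀ = 0`
  (a primitive integer eigenvector `(p, q)` of `γ`, Bézout `x p + y q = 1`, `A = [[x, y], [-q, p]]`);
* `SL2Z.coe_smul_of_apply_one_zero_eq_zero` — an element with `γ₁₀ = 0` acts on `ℍ` as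
  `z ↦ z + γ₀₁ γ₀₀` (an integer translation);
* ★ `SL2Z.exists_conj_smul_eq_add` — `(tr γ)² = 4` ⇒ `∃ A ∈ SL₂(ℤ)`, `∃ h ∈ ℤ`,
  `(A γ A⁻¹) • z = z + h` for all `z ∈ ℍ`; `SL2Z.exists_conj_smul_eq_add_even` — for `γ ∈ Γ(2)` the
  shift `h` is EVEN (`Γ(2)` is normal).

## References

* F. Diamond, J. Shurman, *A First Course in Modular Forms*, GTM 228 (2005), Section 2.4.
  [DiamondShurman2005]
-/

set_option autoImplicit false

noncomputable section

open Matrix Matrix.SpecialLinearGroup ModularGroup UpperHalfPlane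
open scoped MatrixGroups

namespace Literature.NumberTheory.Automorphic

namespace SL2Z

/-- **Conjugating an eigenvector to `e₁`.**  If `(p, q)` is a coprime integer vector with
`γ (p, q)ᵀ = ε (p, q)ᵀ`, then for the Bézout matrix `A = [[x, y], [-q, p]]` (`x p + y q = 1`) the
conjugate `A γ A⁻¹` is upper triangular. [cite: DiamondShurman2005, Section 2.4] -/
theorem exists_conj_apply_one_zero_eq_zero_of_eigenvector (γ : SL(2, ℤ)) {ε p q : ℤ}
    (hpq : IsCoprime p q) (h0 : γ 0 0 * p + γ 0 1 * q = ε * p) (h1 : γ 1 0 * p + γ 1 1 * q = ε * q) :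
    ∃ A : SL(2, ℤ), (A * γ * A⁻¹) 1 0 = 0 := by
  obtain ⟨x, y, hxy⟩ := hpq
  let A : SL(2, ℤ) := ⟨!![x, y; -q, p], by rw [Matrix.det_fin_two_of]; linarith⟩
  refine ⟨A, ?_⟩
  have hAinv : ((A⁻¹ : SL(2, ℤ)) : Matrix (Fin 2) (Fin 2) ℤ) = !![p, -y; q, x] := by
    rw [Matrix.SpecialLinearGroup.coe_inv]
    show Matrix.adjugate !![x, y; -q, p] = _
    rw [Matrix.adjugate_fin_two_of]
    simp
  have hA10 : ((A : SL(2, ℤ)) : Matrix (Fin 2) (Fin 2) ℤ) 1 0 = -q := rfl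
  have hA11 : ((A : SL(2, ℤ)) : Matrix (Fin 2) (Fin 2) ℤ) 1 1 = p := rfl
  have hAi00 : ((A⁻¹ : SL(2, ℤ)) : Matrix (Fin 2) (Fin 2) ℤ) 0 0 = p := by rw [hAinv]; rfl
  have hAi10 : ((A⁻¹ : SL(2, ℤ)) : Matrix (Fin 2) (Fin 2) ℤ) 1 0 = q := by rw [hAinv]; rfl
  show ((A * γ * A⁻¹ : SL(2, ℤ)) : Matrix (Fin 2) (Fin 2) ℤ) 1 0 = 0
  rw [Matrix.SpecialLinearGroup.coe_mul, Matrix.SpecialLinearGroup.coe_mul, Matrix.mul_apply,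
    Fin.sum_univ_two, Matrix.mul_apply, Matrix.mul_apply, Fin.sum_univ_two, Fin.sum_univ_two,
    hA10, hA11, hAi00, hAi10]
  linear_combination (-q) * h0 + p * h1

/-- **A trace-`±2` element of `SL₂(ℤ)` is conjugate in `SL₂(ℤ)` to an upper triangular one**: its
fixed point on `ℙ¹(ℝ)` is a cusp `p/q ∈ ℚ ∪ {∞}`, moved to `∞` by a Bézout matrix.
[cite: DiamondShurman2005, Section 2.4] -/
theorem exists_conj_apply_one_zero_eq_zero (γ : SL(2, ℤ)) (htr : (γ 0 0 + γ 1 1) ^ 2 = 4) :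
    ∃ A : SL(2, ℤ), (A * γ * A⁻¹) 1 0 = 0 := by
  -- `a + d = 2ε` with `ε = ±1`
  obtain ⟨ε, hε, had⟩ : ∃ ε : ℤ, ε ^ 2 = 1 ∧ γ 0 0 + γ 1 1 = 2 * ε := by
    have h : (γ 0 0 + γ 1 1 - 2) * (γ 0 0 + γ 1 1 + 2) = 0 := by nlinarith [htr]
    rcases mul_eq_zero.mp h with h | h
    · exact ⟨1, by norm_num, by linarith⟩
    · exact ⟨-1, by norm_num, by linarith⟩
  have hdet := γ.det_coe
  rw [Matrix.det_fin_two] at hdet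
  -- the (possibly imprimitive) eigenvector `(b, ε - a)`, or `(0, 1)` when it vanishes
  by_cases hcase : γ 0 1 = 0 ∧ γ 0 0 = ε
  · obtain ⟨hb, ha⟩ := hcase
    refine exists_conj_apply_one_zero_eq_zero_of_eigenvector γ (ε := ε) (p := 0) (q := 1)
      isCoprime_one_right ?_ ?_
    · rw [hb]; ring
    · have hd : γ 1 1 = ε := by linarith
      rw [hd]; ring
  · -- `v = (b, ε - a) ≠ 0`; make it primitive
    have hv : γ 0 1 ≠ 0 ∨ ε - γ 0 0 ≠ 0 := by
      by_contra h
      push Not at h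
      exact hcase ⟨h.1, by linarith [h.2]⟩
    obtain ⟨g, p, q, _, hcop1, hp, hq⟩ := Int.exists_gcd_one' (Int.gcd_pos_iff.mpr hv)
    have hcop : IsCoprime p q := Int.isCoprime_iff_gcd_eq_one.mpr hcop1
    have hgZ : (g : ℤ) ≠ 0 := by
      intro h0
      rw [h0, mul_zero] at hp hq
      rcases hv with h | h
      · exact h hp
      · exact h hq
    -- eigenvector equation for `(b, ε - a)`, then for `(p, q)`
    have H1 : γ 1 0 * γ 0 1 + γ 1 1 * (ε - γ 0 0) = ε * (ε - γ 0 0) := by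
      have h2 : ε * (γ 0 0 + γ 1 1) = 2 := by rw [had]; nlinarith [hε]
      linear_combination (-1 : ℤ) * hdet + h2 - hε
    rw [hq, hp] at H1
    refine exists_conj_apply_one_zero_eq_zero_of_eigenvector γ (ε := ε) (p := p) (q := q) hcop ?_ ?_
    · rw [hp]
      have h3 : (g : ℤ) * (γ 0 0 * p + p * g * q - ε * p) = 0 := by
        linear_combination (-(g : ℤ) * p) * hq
      rcases mul_eq_zero.mp h3 with h | h
      · exact absurd h hgZ
      · linarith
    · have h3 : (g : ℤ) * (γ 1 0 * p + γ 1 1 * q - ε * q) = 0 := by linear_combination H1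
      rcases mul_eq_zero.mp h3 with h | h
      · exact absurd h hgZ
      · linarith

/-- **An upper triangular element of `SL₂(ℤ)` acts on `ℍ` as an integer translation**:
`γ₁₀ = 0` ⇒ `γ • z = z + γ₀₁ γ₀₀` (`γ₀₀ = γ₁₁ = ±1`). [cite: DiamondShurman2005, Section 2.4] -/
theorem coe_smul_of_apply_one_zero_eq_zero (γ : SL(2, ℤ)) (hc : γ 1 0 = 0) (z : ℍ) :
    ((γ • z : ℍ) : ℂ) = z + ((γ 0 1 * γ 0 0 : ℤ) : ℂ) := by
  have had := γ.det_coe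
  replace had : γ 0 0 * γ 1 1 = 1 := by rw [det_fin_two, hc] at had; linarith
  rw [UpperHalfPlane.coe_specialLinearGroup_apply]
  simp only [eq_intCast]
  rw [hc]
  push_cast
  rcases Int.eq_one_or_neg_one_of_mul_eq_one' had with (⟨ha, hd⟩ | ⟨ha, hd⟩)
  · rw [ha, hd]; push_cast; ring
  · rw [ha, hd]; push_cast; ring

/-- ★ **A trace-`±2` element of `SL₂(ℤ)` is `SL₂(ℤ)`-conjugate to a translation of `ℍ`**:
`∃ A ∈ SL₂(ℤ)`, `∃ h ∈ ℤ`, `(A γ A⁻¹) • z = z + h` for all `z ∈ ℍ`.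
[cite: DiamondShurman2005, Section 2.4] -/
theorem exists_conj_smul_eq_add (γ : SL(2, ℤ)) (htr : (γ 0 0 + γ 1 1) ^ 2 = 4) :
    ∃ (A : SL(2, ℤ)) (h : ℤ), ∀ z : ℍ, (((A * γ * A⁻¹) • z : ℍ) : ℂ) = z + h := by
  obtain ⟨A, hA⟩ := exists_conj_apply_one_zero_eq_zero γ htr
  exact ⟨A, (A * γ * A⁻¹) 0 1 * (A * γ * A⁻¹) 0 0, fun z =>
    coe_smul_of_apply_one_zero_eq_zero _ hA z⟩

/-- **For `γ ∈ Γ(2)` the translation is EVEN**: `Γ(2)` is normal in `SL₂(ℤ)`, so `A γ A⁻¹ ∈ Γ(2)` has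
even off-diagonal entry and odd diagonal entries. [cite: DiamondShurman2005, Section 2.4] -/
theorem exists_conj_smul_eq_add_even {γ : SL(2, ℤ)} (hγ : γ ∈ CongruenceSubgroup.Gamma 2)
    (htr : (γ 0 0 + γ 1 1) ^ 2 = 4) :
    ∃ (A : SL(2, ℤ)) (h : ℤ), 2 ∣ h ∧ ∀ z : ℍ, (((A * γ * A⁻¹) • z : ℍ) : ℂ) = z + h := by
  obtain ⟨A, hA⟩ := exists_conj_apply_one_zero_eq_zero γ htr
  set M : SL(2, ℤ) := A * γ * A⁻¹ with hM
  have hMmem : M ∈ CongruenceSubgroup.Gamma 2 := by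
    rw [hM]
    exact (CongruenceSubgroup.Gamma_normal 2).conj_mem γ hγ A
  have h01 : (2 : ℤ) ∣ M 0 1 := by
    rw [CongruenceSubgroup.Gamma_mem] at hMmem
    exact (ZMod.intCast_zmod_eq_zero_iff_dvd _ 2).mp hMmem.2.1
  refine ⟨A, M 0 1 * M 0 0, h01.mul_right _, fun z => ?_⟩
  exact coe_smul_of_apply_one_zero_eq_zero M hA z

end SL2Z

end Literature.NumberTheory.Automorphic

end
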